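import Literature.AnabelianGeometry.SemiGraphs.TemperedAnabelianThm66Sub
import Mathlib.Topology.Algebra.Group.Quotient
import Mathlib.Tactic.Group
import HarnessLib

/-!
# [SemiAnbd] Theorem 6.6 sub-DAG: non-vacuity of `SpecializationIsoSystem`

Mochizuki, *Semi-graphs of anabelioids*, Publ. RIMS **42** (2006) [SemiAnbd], §6, Theorem 6.6,
proof pp. 72–73. [cite: MochizukiSemiAnbd2006, Thm 6.6 pp.72-73]

Proof-only companion of `TemperedAnabelianThm66Sub.lean` (abc-iut cell, sub-DAG
`plan/L3/SUBDAG-SemiAnbd-Thm66.md`; cell referee criterion VACUITY): the data type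
`TemperedCurve.SpecializationIsoSystem X Y α̂` (rows L02–L07 of the printed proof) is INHABITED as
soon as (a) some tempered isomorphism `β` lies under `α̂` and (b) `Π_{X_K}` has a decreasing cofinal
sequence of open normal subgroups — by the TRIVIAL tower `J_X = J_Y = 1`, `β_H = β` (the reviewer's
model for p414866).  Together with `SpecializationIsoSystem.exists_liesUnder` (companion
`TemperedAnabelianThm66SubProofs.lean`) this shows that, over a `Π_{X_K}` with such a sequence, the
existence of a specialisation isomorphism system for `α̂` is EQUIVALENT to the existence half of the
typed Theorem 6.6 for `α̂`: the structure is exactly as strong as what it is used to prove, and its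
only non-formal content is the geometric CONSTRUCTION of the tower recorded in print ([Mzk3]
Lem. 2.3, §3, Ex. 5.6).  Classical; nothing here takes a side on [IUTchIII] Cor. 3.12.
-/

noncomputable section

namespace Literature.AnabelianGeometry.SemiGraphs

open _root_.Topology

namespace TemperedCurve

variable {p : ℕ} [Fact p.Prime]

/-- **Non-vacuity of the specialisation isomorphism system** ([SemiAnbd] Thm 6.6 proof,
pp. 72–73, rows L02–L07): if a tempered isomorphism `β` lies under `α̂` and `Π_{X_K}` has a
decreasing cofinal sequence `H n` of open normal subgroups, the trivial tower (`J_X = J_Y = 1`,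
`β_H := β`, `H_Y := α̂(H_X)`) is a `SpecializationIsoSystem X Y α̂`.
[cite: MochizukiSemiAnbd2006, Thm 6.6 proof pp.72-73] -/
theorem nonempty_specializationIsoSystem_of_liesUnder {X Y : TemperedCurve p}
    (αhat : X.PiHat ≃ₜ* Y.PiHat) (β : X.PiTemp ≃ₜ* Y.PiTemp) (hβ : LiesUnder X Y αhat β)
    (H : ℕ → Subgroup X.PiHat) (hopen : ∀ n, IsOpen (H n : Set X.PiHat))
    (hnormal : ∀ n, (H n).Normal) (hanti : Antitone H)
    (hcofinal : ∀ U : Set X.PiHat, IsOpen U → (1 : X.PiHat) ∈ U → ∃ n, (H n : Set X.PiHat) ⊆ U) :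
    Nonempty (SpecializationIsoSystem X Y αhat) := by
  obtain ⟨c, hc⟩ := hβ
  haveI : T2Space X.PiHat := X.isProfiniteCompletion_toHat.t2Space
  haveI : T2Space Y.PiHat := Y.isProfiniteCompletion_toHat.t2Space
  -- closedness of the trivial subgroup of `Π^temp` (pull back `{1}` along the injection `ι`)
  have hbotX : IsClosed ((⊥ : Subgroup X.PiTemp) : Set X.PiTemp) := by
    have : ((⊥ : Subgroup X.PiTemp) : Set X.PiTemp) = X.toHat ⁻¹' {1} := by
      ext x
      simp only [Subgroup.coe_bot, Set.mem_singleton_iff, Set.mem_preimage]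
      constructor
      · rintro rfl; exact map_one _
      · intro h; exact X.toHat_injective (by rw [h, map_one])
    rw [this]; exact isClosed_singleton.preimage X.toHat.continuous
  have hbotY : IsClosed ((⊥ : Subgroup Y.PiTemp) : Set Y.PiTemp) := by
    have : ((⊥ : Subgroup Y.PiTemp) : Set Y.PiTemp) = Y.toHat ⁻¹' {1} := by
      ext y
      simp only [Subgroup.coe_bot, Set.mem_singleton_iff, Set.mem_preimage]
      constructor
      · rintro rfl; exact map_one _
      · intro h; exact Y.toHat_injective (by rw [h, map_one])
    rw [this]; exact isClosed_singleton.preimage Y.toHat.continuous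
  -- the initial-topology and completeness properties for the trivial system
  have hinit : ∀ {T : Type} [Group T] [TopologicalSpace T] [IsTopologicalGroup T] (U : Set T),
      IsOpen U → (1 : T) ∈ U → ∃ (_ : ℕ), ∃ W : Set (T ⧸ (⊥ : Subgroup T)), IsOpen W ∧
        ((1 : T) : T ⧸ (⊥ : Subgroup T)) ∈ W ∧ QuotientGroup.mk ⁻¹' W ⊆ U := by
    intro T _ _ _ U hU h1
    refine ⟨0, QuotientGroup.mk '' U, QuotientGroup.isOpenMap_coe _ hU, ⟨1, h1, rfl⟩, ?_⟩
    rintro t ⟨u, hu, hut⟩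
    have : u⁻¹ * t ∈ (⊥ : Subgroup T) := QuotientGroup.eq.mp hut
    rw [Subgroup.mem_bot, inv_mul_eq_one] at this
    exact this ▸ hu
  have hcompl : ∀ {T : Type} [Group T] (s : ℕ → T), (∀ n, (s n)⁻¹ * s (n + 1) ∈ (⊥ : Subgroup T)) →
      ∃ t : T, ∀ n, t⁻¹ * s n ∈ (⊥ : Subgroup T) := by
    intro T _ s hs
    refine ⟨s 0, fun n => ?_⟩
    induction n with
    | zero => simp
    | succ n ih =>
      have := (⊥ : Subgroup T).mul_mem ih (hs n)
      simpa [mul_assoc] using this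
  -- the level isomorphisms `Π^temp_X / 1 ≃ₜ* Π^temp_Y / 1` induced by `β` (Mathlib `QuotientGroup.congr`,
  -- continuity of both directions read off through the quotient maps)
  have hcont : Continuous (QuotientGroup.congr ⊥ ⊥ β.toMulEquiv (Subgroup.map_bot _)) := by
    refine (QuotientGroup.isQuotientMap_mk (⊥ : Subgroup X.PiTemp)).continuous_iff.mpr ?_
    have : (⇑(QuotientGroup.congr ⊥ ⊥ β.toMulEquiv (Subgroup.map_bot _)) ∘
        (QuotientGroup.mk : X.PiTemp → X.PiTemp ⧸ (⊥ : Subgroup X.PiTemp))) =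
        QuotientGroup.mk ∘ β := by
      funext x
      exact QuotientGroup.congr_mk ⊥ ⊥ β.toMulEquiv (Subgroup.map_bot _) x
    rw [this]
    exact QuotientGroup.continuous_mk.comp β.continuous
  have hcont' : Continuous (QuotientGroup.congr ⊥ ⊥ β.toMulEquiv (Subgroup.map_bot _)).symm := by
    refine (QuotientGroup.isQuotientMap_mk (⊥ : Subgroup Y.PiTemp)).continuous_iff.mpr ?_
    have : (⇑(QuotientGroup.congr ⊥ ⊥ β.toMulEquiv (Subgroup.map_bot _)).symm ∘
        (QuotientGroup.mk : Y.PiTemp → Y.PiTemp ⧸ (⊥ : Subgroup Y.PiTemp))) =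
        QuotientGroup.mk ∘ β.symm := by
      funext y
      rw [QuotientGroup.congr_symm]
      exact QuotientGroup.congr_mk ⊥ ⊥ β.toMulEquiv.symm _ y
    rw [this]
    exact QuotientGroup.continuous_mk.comp β.symm.continuous
  let βq : X.PiTemp ⧸ (⊥ : Subgroup X.PiTemp) ≃ₜ* Y.PiTemp ⧸ (⊥ : Subgroup Y.PiTemp) :=
    ContinuousMulEquiv.mk (QuotientGroup.congr ⊥ ⊥ β.toMulEquiv (Subgroup.map_bot _)) hcont hcont'
  have hβq : ∀ g : X.PiTemp, βq (g : X.PiTemp ⧸ (⊥ : Subgroup X.PiTemp)) =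
      ((β g : Y.PiTemp) : Y.PiTemp ⧸ (⊥ : Subgroup Y.PiTemp)) := fun g =>
    QuotientGroup.congr_mk ⊥ ⊥ β.toMulEquiv (Subgroup.map_bot _) g
  refine ⟨{
    HX := H
    isOpen_HX := hopen
    normal_HX := hnormal
    antitone_HX := hanti
    cofinal_HX := hcofinal
    HY := fun n => (H n).map αhat.toMulEquiv.toMonoidHom
    HY_eq := fun n => rfl
    JX := fun _ => ⊥
    JY := fun _ => ⊥
    isClosed_JX := fun _ => hbotX
    isClosed_JY := fun _ => hbotY
    antitone_JX := fun _ _ _ => le_rfl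
    antitone_JY := fun _ _ _ => le_rfl
    JX_le := fun _ => bot_le
    JY_le := fun _ => bot_le
    initial_JX := fun U hU h1 => hinit U hU h1
    initial_JY := fun U hU h1 => hinit U hU h1
    complete_JX := fun s hs => hcompl s hs
    complete_JY := fun s hs => hcompl s hs
    β := fun _ => βq
    underHat := fun n => ⟨c, fun g y h => ?_⟩
    compat := fun n => ⟨1, fun g y y' h' h => ?_⟩ }⟩
  · -- `β_H[g] = [y]` in `Π^temp_Y / 1` means `β g = y`; then the discrepancy is `1`
    change βq (g : X.PiTemp ⧸ (⊥ : Subgroup X.PiTemp)) = _ at h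
    rw [hβq] at h
    have hy : β g = y := by
      have := QuotientGroup.eq.mp h
      rwa [Subgroup.mem_bot, inv_mul_eq_one] at this
    rw [← hy, ← hc g, inv_mul_cancel]
    exact Subgroup.one_mem _
  · change βq (g : X.PiTemp ⧸ (⊥ : Subgroup X.PiTemp)) = _ at h
    change βq (g : X.PiTemp ⧸ (⊥ : Subgroup X.PiTemp)) = _ at h'
    rw [hβq] at h h'
    have hy : β g = y := by
      have := QuotientGroup.eq.mp h
      rwa [Subgroup.mem_bot, inv_mul_eq_one] at this
    have hy' : β g = y' := by
      have := QuotientGroup.eq.mp h'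
      rwa [Subgroup.mem_bot, inv_mul_eq_one] at this
    rw [← hy, ← hy', Subgroup.mem_bot]
    group

end TemperedCurve

end Literature.AnabelianGeometry.SemiGraphs

end
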